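import Literature.RingTheory.Flat.NormalityGoesUp
import Literature.RingTheory.Etale.WeaklyEtaleOverField

/-!
# Olivier's theorem: weakly étale local algebras over a strictly henselian local ring

[cite: StacksProject, Tag 092Z (de Jong's proof); BhattScholze2015 = arXiv:1309.1198v2,
Theorem 2.3.5 (Olivier) and Theorem 2.3.4]

Let `R` be a local ring whose residue field is separably closed and such that every integral
`R`-algebra which is a domain is local (both hold for strictly henselian `R`; for the local rings
of a ring with pointed retractions of étale algebras they are proved in
`Literature/RingTheory/Etale/PointedRetractionHenselian.lean`).  Let `R → S` be a local,
weakly étale map of local rings.  Then `R → S` is bijective (`bijective_algebraMap_of_weaklyEtale`).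

We follow de Jong's proof in the Stacks project:
* the closed fibre is trivial (`exists_sub_algebraMap_mem`), by the structure of weakly étale
  algebras over separably closed fields;
* **key lemma** (`isIdempotentElem_trivial`): for every field `L` over `R`, `L ⊗[R] S` has no
  non-trivial idempotents — an idempotent lies in `A' ⊗[R] S` (`A'` the integral closure of `R`
  in `L`) by *normality goes up* (Stacks 092W), and `A' ⊗[R] S` is local;
* hence every fibre `κ(𝔭) ⊗[R] S` is `κ(𝔭)` (pass to the algebraic closure of `κ(𝔭)` and
  descend), so `S ⊗[R] S → S` is bijective on spectra, its pure kernel is nil, hence zero, and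
  `R → S` is a faithfully flat epimorphism, i.e. bijective.
-/

universe u

namespace Literature.RingTheory.Etale

open TensorProduct IsLocalRing

noncomputable section

/-! ### The integral closure of `R` in a field -/

section IntClosure

variable (R : Type u) [CommRing R] (L : Type u) [Field L] [Algebra R L]

/-- The integral closure of (the image of) `R` in `L`, as a subring. [cite: StacksProject,
Tag 092Z] -/
abbrev intClosure : Subring L := (integralClosure R L).toSubring

/-- `R`-algebra structure on the integral closure. [folklore] -/
instance algebraIntClosure : Algebra R (intClosure R L) :=
  ((algebraMap R L).codRestrict (intClosure R L) fun _ => isIntegral_algebraMap).toAlgebra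

/-- Tower `R → A' → L`. [folklore] -/
instance isScalarTower_intClosure : IsScalarTower R (intClosure R L) L :=
  IsScalarTower.of_algebraMap_eq fun _ => rfl

/-- `A'` is integral over `R`. [folklore] -/
theorem isIntegral_intClosure : Algebra.IsIntegral R (intClosure R L) := by
  refine ⟨fun x => ?_⟩
  let ι : intClosure R L →ₐ[R] L :=
    { (intClosure R L).subtype with commutes' := fun _ => rfl }
  exact (isIntegral_algHom_iff ι Subtype.val_injective).1 x.2

end IntClosure

variable (R S : Type u) [CommRing R] [IsLocalRing R] [CommRing S] [IsLocalRing S]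
  [Algebra R S] [IsLocalHom (algebraMap R S)] [Algebra.WeaklyEtale R S]

/-! ### The closed fibre -/

omit [IsLocalRing S] [IsLocalHom (algebraMap R S)] [Algebra.WeaklyEtale R S] in
/-- `S → κ_R ⊗[R] S`, `s ↦ 1 ⊗ s`, is surjective. [folklore] -/
theorem includeRight_residueField_surjective :
    Function.Surjective (Algebra.TensorProduct.includeRight :
      S →ₐ[R] ResidueField R ⊗[R] S) := by
  intro x
  induction x using TensorProduct.induction_on with
  | zero => exact ⟨0, map_zero _⟩
  | tmul c s =>
    obtain ⟨r, rfl⟩ := IsLocalRing.residue_surjective c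
    refine ⟨r • s, ?_⟩
    change (1 : ResidueField R) ⊗ₜ[R] (r • s) = residue R r ⊗ₜ[R] s
    rw [← TensorProduct.smul_tmul, ← IsLocalRing.ResidueField.algebraMap_eq,
      Algebra.algebraMap_eq_smul_one]
  | add x y hx hy =>
    obtain ⟨s, rfl⟩ := hx; obtain ⟨t, rfl⟩ := hy
    exact ⟨s + t, map_add _ _ _⟩

/-- **The closed fibre of a local weakly étale map with separably closed residue field is
trivial**: every `s ∈ S` is congruent to an element of `R` modulo `𝔪_R S`.
[cite: StacksProject, Tag 092Z] -/
theorem exists_sub_algebraMap_mem [IsSepClosed (ResidueField R)] (s : S) :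
    ∃ r : R, s - algebraMap R S r ∈ (maximalIdeal R).map (algebraMap R S) := by
  haveI : Module.FaithfullyFlat R S := Module.FaithfullyFlat.of_flat_of_isLocalHom
  have hsurj := includeRight_residueField_surjective R S
  haveI : IsLocalRing (ResidueField R ⊗[R] S) :=
    IsLocalRing.of_surjective'
      (Algebra.TensorProduct.includeRight : S →ₐ[R] ResidueField R ⊗[R] S).toRingHom hsurj
  have hbij := bijective_algebraMap_of_weaklyEtale_of_isSepClosed (ResidueField R)
    (ResidueField R ⊗[R] S)
  obtain ⟨c, hc⟩ := hbij.2 ((1 : ResidueField R) ⊗ₜ[R] s)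
  obtain ⟨r, rfl⟩ := IsLocalRing.residue_surjective c
  refine ⟨r, ?_⟩
  have h0 : ((1 : ResidueField R) ⊗ₜ[R] (s - algebraMap R S r) : ResidueField R ⊗[R] S) = 0 := by
    rw [TensorProduct.tmul_sub, ← hc, Algebra.TensorProduct.algebraMap_apply,
      Algebra.algebraMap_self, RingHom.id_apply, sub_eq_zero, Algebra.algebraMap_eq_smul_one,
      ← TensorProduct.smul_tmul, ← IsLocalRing.ResidueField.algebraMap_eq,
      Algebra.algebraMap_eq_smul_one]
  have h1 : TensorProduct.quotTensorEquivQuotSMul S (maximalIdeal R)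
      ((1 : R ⧸ maximalIdeal R) ⊗ₜ[R] (s - algebraMap R S r)) = 0 := by
    rw [show ((1 : R ⧸ maximalIdeal R) ⊗ₜ[R] (s - algebraMap R S r) : (R ⧸ maximalIdeal R) ⊗[R] S)
      = 0 from h0, map_zero]
  rw [TensorProduct.quotTensorEquivQuotSMul_mk_one_tmul, Submodule.Quotient.mk_eq_zero,
    Ideal.smul_top_eq_map] at h1
  exact h1

/-! ### The key lemma: no idempotents in `L ⊗[R] S` -/

section KeyLemma

variable [IsSepClosed (ResidueField R)]
  (hloc : ∀ (D : Type u) [CommRing D] [IsDomain D] [Algebra R D],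
    Algebra.IsIntegral R D → IsLocalRing D)
  (L : Type u) [Field L] [Algebra R L]

include hloc in
/-- `A' ⊗[R] S` is local: `𝔪_R (A' ⊗ S)` lies in the Jacobson radical (integrality over the local
ring `S`) and modulo it every element is congruent to some `a ⊗ 1`, `A'` being local.
[cite: StacksProject, Tag 092Z] -/
theorem isLocalRing_intClosure_tensor : IsLocalRing (intClosure R L ⊗[R] S) := by
  set A := intClosure R L
  haveI : Module.FaithfullyFlat R S := Module.FaithfullyFlat.of_flat_of_isLocalHom
  haveI : Algebra.IsIntegral R A := isIntegral_intClosure R L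
  haveI : IsLocalRing A := hloc A (isIntegral_intClosure R L)
  set B₀ := A ⊗[R] S
  set J : Ideal B₀ := (maximalIdeal R).map (algebraMap R B₀) with hJ
  -- `J` lies in every maximal ideal
  have hJn : ∀ n : Ideal B₀, n.IsMaximal → J ≤ n := by
    intro n hn
    let θ : B₀ ≃ₐ[R] S ⊗[R] A := Algebra.TensorProduct.comm R A S
    haveI : (n.comap θ.symm.toRingHom).IsMaximal :=
      Ideal.comap_isMaximal_of_surjective _ θ.symm.surjective
    have hmax : ((n.comap θ.symm.toRingHom).comap (algebraMap S (S ⊗[R] A))).IsMaximal :=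
      Ideal.isMaximal_comap_of_isIntegral_of_isMaximal _
    have heq : (n.comap θ.symm.toRingHom).comap (algebraMap S (S ⊗[R] A)) = maximalIdeal S :=
      IsLocalRing.eq_maximalIdeal hmax
    rw [hJ, Ideal.map_le_iff_le_comap]
    intro r hr
    have h1 : algebraMap R S r ∈ maximalIdeal S := by
      rw [IsLocalRing.mem_maximalIdeal, mem_nonunits_iff, isUnit_map_iff]
      exact hr
    rw [← heq, Ideal.mem_comap, Ideal.mem_comap, Algebra.TensorProduct.algebraMap_apply,
      Algebra.algebraMap_self, RingHom.id_apply] at h1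
    change θ.symm ((algebraMap R S r) ⊗ₜ[R] (1 : A)) ∈ n at h1
    rw [Algebra.TensorProduct.comm_symm_tmul] at h1
    rw [Ideal.mem_comap, ← (Algebra.TensorProduct.includeRight (R := R) (A := A) (B := S)).commutes r]
    exact h1
  have hJ_jac : J ≤ Ideal.jacobson ⊥ := le_sInf fun n hn => hJn n hn.2
  have hjac : ∀ x ∈ J, ∀ y, IsUnit (x * y + 1) := fun x hx y =>
    Ideal.mem_jacobson_bot.1 (hJ_jac hx) y
  -- `1 ⊗ x ∈ J` for `x ∈ 𝔪_R S`
  have hJ' : ∀ x ∈ (maximalIdeal R).map (algebraMap R S), (1 : A) ⊗ₜ[R] x ∈ J := by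
    intro x hx
    have hmap : ((maximalIdeal R).map (algebraMap R S)).map
        (Algebra.TensorProduct.includeRight (R := R) (A := A) (B := S)) ≤ J := by
      rw [hJ, Ideal.map_le_iff_le_comap, Ideal.map_le_iff_le_comap]
      intro r hr
      rw [Ideal.mem_comap, Ideal.mem_comap, AlgHom.commutes]
      exact Ideal.mem_map_of_mem _ hr
    have := hmap (Ideal.mem_map_of_mem _ hx)
    exact this
  -- every element is `a ⊗ 1` modulo `J`
  have hdec : ∀ b : B₀, ∃ a : A, b - a ⊗ₜ[R] (1 : S) ∈ J := by
    intro b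
    induction b using TensorProduct.induction_on with
    | zero => exact ⟨0, by simp⟩
    | tmul a s =>
      obtain ⟨r, hr⟩ := exists_sub_algebraMap_mem R S s
      refine ⟨r • a, ?_⟩
      have : a ⊗ₜ[R] s - (r • a) ⊗ₜ[R] (1 : S) =
          (a ⊗ₜ[R] (1 : S)) * ((1 : A) ⊗ₜ[R] (s - algebraMap R S r)) := by
        rw [Algebra.TensorProduct.tmul_mul_tmul, mul_one, one_mul, TensorProduct.tmul_sub,
          TensorProduct.smul_tmul, Algebra.algebraMap_eq_smul_one]
      rw [this]
      exact Ideal.mul_mem_left _ _ (hJ' _ hr)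
    | add b₁ b₂ h₁ h₂ =>
      obtain ⟨a₁, ha₁⟩ := h₁
      obtain ⟨a₂, ha₂⟩ := h₂
      refine ⟨a₁ + a₂, ?_⟩
      have : b₁ + b₂ - (a₁ + a₂) ⊗ₜ[R] (1 : S) = (b₁ - a₁ ⊗ₜ[R] 1) + (b₂ - a₂ ⊗ₜ[R] 1) := by
        rw [TensorProduct.add_tmul]; abel
      rw [this]
      exact J.add_mem ha₁ ha₂
  -- conclusion
  refine IsLocalRing.of_isUnit_or_isUnit_one_sub_self fun b => ?_
  obtain ⟨a, ha⟩ := hdec b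
  rcases IsLocalRing.isUnit_or_isUnit_one_sub_self a with hu | hu
  · left
    obtain ⟨u, hu'⟩ := hu
    have hua : IsUnit (a ⊗ₜ[R] (1 : S)) :=
      hu' ▸ (Units.isUnit u).map (Algebra.TensorProduct.includeLeft (R := R) (S := R) (A := A) (B := S))
    have hu1 : (a ⊗ₜ[R] (1 : S)) * ((↑u⁻¹ : A) ⊗ₜ[R] (1 : S)) = 1 := by
      rw [Algebra.TensorProduct.tmul_mul_tmul, one_mul, ← hu', Units.mul_inv,
        Algebra.TensorProduct.one_def]
    have hb : b = (a ⊗ₜ[R] (1 : S)) *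
        ((b - a ⊗ₜ[R] (1 : S)) * ((↑u⁻¹ : A) ⊗ₜ[R] (1 : S)) + 1) := by
      linear_combination (-(b - a ⊗ₜ[R] (1 : S))) * hu1
    rw [hb]
    exact hua.mul (hjac _ ha _)
  · right
    obtain ⟨u, hu'⟩ := hu
    have hua : IsUnit ((1 - a) ⊗ₜ[R] (1 : S)) :=
      hu' ▸ (Units.isUnit u).map (Algebra.TensorProduct.includeLeft (R := R) (S := R) (A := A) (B := S))
    have hu1 : ((1 - a) ⊗ₜ[R] (1 : S)) * ((↑u⁻¹ : A) ⊗ₜ[R] (1 : S)) = 1 := by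
      rw [Algebra.TensorProduct.tmul_mul_tmul, one_mul, ← hu', Units.mul_inv,
        Algebra.TensorProduct.one_def]
    have hv : (1 - a) ⊗ₜ[R] (1 : S) = 1 - a ⊗ₜ[R] (1 : S) := by
      rw [TensorProduct.sub_tmul, ← Algebra.TensorProduct.one_def]
    have hb : 1 - b = ((1 - a) ⊗ₜ[R] (1 : S)) *
        ((-(b - a ⊗ₜ[R] (1 : S))) * ((↑u⁻¹ : A) ⊗ₜ[R] (1 : S)) + 1) := by
      linear_combination (b - a ⊗ₜ[R] (1 : S)) * hu1 - hv
    rw [hb]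
    exact hua.mul (hjac _ (J.neg_mem ha) _)

include hloc in
/-- **Key lemma (de Jong).** For every field `L` over `R`, the ring `L ⊗[R] S` has only the
trivial idempotents: an idempotent `e` is integral over `A' ⊗[R] S` (`A'` the integral closure
of `R` in `L`), hence lies in `A' ⊗[R] S` by normality going up (Stacks 092W), which is a
local ring. [cite: StacksProject, Tag 092Z] -/
theorem isIdempotentElem_trivial (e : L ⊗[R] S) (he : IsIdempotentElem e) : e = 0 ∨ e = 1 := by
  set A := intClosure R L
  haveI : IsLocalRing (A ⊗[R] S) := isLocalRing_intClosure_tensor R S hloc L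
  let γ : L ⊗[A] (A ⊗[R] S) ≃ₐ[A] L ⊗[R] S := Algebra.TensorProduct.cancelBaseChange R A A L S
  set e' := γ.symm e with he'def
  have he' : IsIdempotentElem e' := he.map γ.symm
  have hmonic : (Polynomial.X ^ 2 - Polynomial.X : Polynomial (A ⊗[R] S)).Monic :=
    (Polynomial.monic_X_pow 2).sub_of_left (by
      rw [Polynomial.degree_X_pow, Polynomial.degree_X]; norm_num)
  obtain ⟨b, hb⟩ := Literature.RingTheory.Flat.exists_eq_one_tmul_of_isIntegral A (A ⊗[R] S)
    e' (Polynomial.X ^ 2 - Polynomial.X) hmonic (by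
      rw [Polynomial.eval₂_sub, Polynomial.eval₂_X_pow, Polynomial.eval₂_X, sq, he'.eq, sub_self])
  have hbb : IsIdempotentElem b := by
    apply Literature.RingTheory.Flat.one_tmul_injective A (A ⊗[R] S) (K := L)
    change (1 : L) ⊗ₜ[A] (b * b) = (1 : L) ⊗ₜ[A] b
    rw [← one_mul (1 : L), ← Algebra.TensorProduct.tmul_mul_tmul, one_mul, hb]
    exact he'.eq
  have hb01 : b = 0 ∨ b = 1 := by
    rcases IsLocalRing.isUnit_or_isUnit_one_sub_self b with hu | hu
    · right
      obtain ⟨u, rfl⟩ := hu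
      have := hbb.eq
      calc (u : A ⊗[R] S) = ↑u⁻¹ * (↑u * ↑u) := by rw [← mul_assoc, Units.inv_mul, one_mul]
        _ = ↑u⁻¹ * ↑u := by rw [this]
        _ = 1 := Units.inv_mul u
    · left
      have h1 : (1 - b) * b = 0 := by rw [sub_mul, one_mul, hbb.eq, sub_self]
      obtain ⟨u, hu'⟩ := hu
      calc b = ↑u⁻¹ * ((1 - b) * b) := by rw [← mul_assoc, ← hu', Units.inv_mul, one_mul]
        _ = 0 := by rw [h1, mul_zero]
  have he'01 : e' = 0 ∨ e' = 1 := by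
    rcases hb01 with rfl | rfl
    · left; rw [← hb, TensorProduct.tmul_zero]
    · right; rw [← hb]; rfl
  rcases he'01 with h | h
  · left
    calc e = γ e' := (γ.apply_symm_apply e).symm
      _ = 0 := by rw [h, map_zero]
  · right
    calc e = γ e' := (γ.apply_symm_apply e).symm
      _ = 1 := by rw [h, map_one]

end KeyLemma

/-! ### All fibres are trivial -/

section Fibres

variable [IsSepClosed (ResidueField R)]
  (hloc : ∀ (D : Type u) [CommRing D] [IsDomain D] [Algebra R D],
    Algebra.IsIntegral R D → IsLocalRing D)

include hloc in
/-- **Every fibre `κ(𝔭) ⊗[R] S` is `κ(𝔭)`**: over the algebraic closure `L` of `κ(𝔭)` the ring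
`L ⊗[R] S` is weakly étale, non-zero and without non-trivial idempotents, hence equal to `L`;
descend along the faithfully flat `κ(𝔭) → L`. [cite: StacksProject, Tag 092Z] -/
theorem bijective_algebraMap_fiber (p : Ideal R) [p.IsPrime] :
    Function.Bijective (algebraMap p.ResidueField (p.ResidueField ⊗[R] S)) := by
  haveI : Module.FaithfullyFlat R S := Module.FaithfullyFlat.of_flat_of_isLocalHom
  set k := p.ResidueField
  let L := AlgebraicClosure k
  have hL : Function.Bijective (algebraMap L (L ⊗[R] S)) :=
    bijective_algebraMap_of_weaklyEtale_of_idempotents L (L ⊗[R] S)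
      (isIdempotentElem_trivial R S hloc L)
  haveI : Module.FaithfullyFlat k L :=
    Module.FaithfullyFlat.of_linearEquiv _ _ (Module.Free.chooseBasis k L).repr
  refine Module.FaithfullyFlat.bijective_of_tensorProduct (R := k) (S := L) (T := k ⊗[R] S) ?_
  let γ : L ⊗[k] (k ⊗[R] S) ≃ₐ[L] L ⊗[R] S := Algebra.TensorProduct.cancelBaseChange R k L L S
  have key : (algebraMap L (L ⊗[k] (k ⊗[R] S)) : L → L ⊗[k] (k ⊗[R] S)) =
      γ.symm ∘ algebraMap L (L ⊗[R] S) := funext fun x => (γ.symm.commutes x).symm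
  rw [key]
  exact γ.symm.bijective.comp hL

include hloc in
/-- **At most one prime of `S` lies over each prime of `R`.** [cite: StacksProject, Tag 092Z] -/
theorem eq_of_liesOver (p : Ideal R) [p.IsPrime] (q₁ q₂ : Ideal S) [q₁.IsPrime] [q₂.IsPrime]
    [q₁.LiesOver p] [q₂.LiesOver p] : q₁ = q₂ := by
  set k := p.ResidueField
  let e : k ≃+* (k ⊗[R] S) := RingEquiv.ofBijective _ (bijective_algebraMap_fiber R S hloc p)
  haveI : Subsingleton (PrimeSpectrum (p.Fiber S)) :=
    (PrimeSpectrum.comapEquiv e).toEquiv.symm.subsingleton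
  let φ := PrimeSpectrum.primesOverOrderIsoFiber R S p
  have h := φ.injective (Subsingleton.elim (φ ⟨q₁, ‹q₁.IsPrime›, ‹q₁.LiesOver p›⟩)
    (φ ⟨q₂, ‹q₂.IsPrime›, ‹q₂.LiesOver p›⟩))
  exact congrArg Subtype.val h

include hloc in
/-- **Trivial residue field extensions**, elementwise: for `q` over `p` and `s ∈ S` there are
`a, b ∈ R`, `b ∉ p`, with `b s ≡ a (mod q)`. [cite: StacksProject, Tag 092Z] -/
theorem exists_sub_mem_of_liesOver (p : Ideal R) [p.IsPrime] (q : Ideal S) [q.IsPrime]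
    [q.LiesOver p] (s : S) : ∃ a b : R, b ∉ p ∧ b • s - algebraMap R S a ∈ q := by
  set k := p.ResidueField
  obtain ⟨c, hc⟩ := (bijective_algebraMap_fiber R S hloc p).2 ((1 : k) ⊗ₜ[R] s)
  -- write `c = a / b`
  obtain ⟨x, rfl⟩ := IsLocalRing.residue_surjective c
  obtain ⟨⟨a, b⟩, rfl⟩ := IsLocalization.mk'_surjective p.primeCompl x
  refine ⟨a, b, b.2, ?_⟩
  have hab : algebraMap R k b * IsLocalRing.residue _ (IsLocalization.mk' _ a b) =
      algebraMap R k a := by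
    rw [IsScalarTower.algebraMap_apply R (Localization.AtPrime p) k,
      IsScalarTower.algebraMap_apply R (Localization.AtPrime p) k,
      IsLocalRing.ResidueField.algebraMap_eq, ← map_mul, mul_comm, IsLocalization.mk'_spec]
  -- `1 ⊗ (b s - a) = 0`
  have h0 : ((1 : k) ⊗ₜ[R] ((b : R) • s - algebraMap R S a) : k ⊗[R] S) = 0 := by
    rw [TensorProduct.tmul_sub, TensorProduct.tmul_smul, ← hc, Algebra.TensorProduct.algebraMap_apply,
      Algebra.algebraMap_self, RingHom.id_apply, TensorProduct.smul_tmul', Algebra.smul_def, hab,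
      sub_eq_zero]
    change _ = Algebra.TensorProduct.includeRight (algebraMap R S a)
    rw [AlgHom.commutes, Algebra.TensorProduct.algebraMap_apply]
  -- the prime of the fibre corresponding to `q`
  let φ := PrimeSpectrum.primesOverOrderIsoFiber R S p
  let Q := φ ⟨q, ‹q.IsPrime›, ‹q.LiesOver p›⟩
  have hqQ : q = Q.asIdeal.comap (Algebra.TensorProduct.includeRight (R := R) (A := k) (B := S)) := by
    have := φ.symm_apply_apply ⟨q, ‹q.IsPrime›, ‹q.LiesOver p›⟩
    have h2 := PrimeSpectrum.coe_primesOverOrderIsoFiber_symm_apply (R := R) (S := S) (p := p) Q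
    rw [this] at h2
    exact h2
  rw [hqQ, Ideal.mem_comap]
  change (1 : k) ⊗ₜ[R] ((b : R) • s - algebraMap R S a) ∈ Q.asIdeal
  rw [h0]
  exact Q.asIdeal.zero_mem

end Fibres

/-! ### Olivier's theorem -/

section Olivier

variable [IsSepClosed (ResidueField R)]
  (hloc : ∀ (D : Type u) [CommRing D] [IsDomain D] [Algebra R D],
    Algebra.IsIntegral R D → IsLocalRing D)

include hloc in
/-- The kernel of `S ⊗[R] S → S` is contained in every prime. [cite: StacksProject, Tag 092Z] -/
theorem ker_lmul'_le (P : Ideal (S ⊗[R] S)) [P.IsPrime] :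
    RingHom.ker (Algebra.TensorProduct.lmul' R (S := S)) ≤ P := by
  set T := S ⊗[R] S
  let p : Ideal R := P.under R
  let iL : S →ₐ[R] T := Algebra.TensorProduct.includeLeft (S := R) (A := S) (B := S)
  let iR : S →ₐ[R] T := Algebra.TensorProduct.includeRight (R := R) (A := S) (B := S)
  let q₁ : Ideal S := P.comap (iL : S →+* T)
  let q₂ : Ideal S := P.comap (iR : S →+* T)
  haveI : q₁.IsPrime := Ideal.comap_isPrime _ P
  haveI : q₂.IsPrime := Ideal.comap_isPrime _ P
  haveI : q₁.LiesOver p := ⟨by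
    change P.comap (algebraMap R T) = (P.comap (iL : S →+* T)).comap (algebraMap R S)
    rw [Ideal.comap_comap, AlgHom.comp_algebraMap]⟩
  haveI : q₂.LiesOver p := ⟨by
    change P.comap (algebraMap R T) = (P.comap (iR : S →+* T)).comap (algebraMap R S)
    rw [Ideal.comap_comap, AlgHom.comp_algebraMap]⟩
  have hq : q₁ = q₂ := eq_of_liesOver R S hloc p q₁ q₂
  -- generators `1 ⊗ s - s ⊗ 1` lie in `P`
  have hgen : ∀ s : S, (1 : S) ⊗ₜ[R] s - s ⊗ₜ[R] (1 : S) ∈ P := by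
    intro s
    obtain ⟨a, b, hb, hmem⟩ := exists_sub_mem_of_liesOver R S hloc p q₁ s
    have h1 : (b • s - algebraMap R S a) ⊗ₜ[R] (1 : S) ∈ P := hmem
    have h2 : (1 : S) ⊗ₜ[R] (b • s - algebraMap R S a) ∈ P := by rw [hq] at hmem; exact hmem
    have e0 : (1 : S) ⊗ₜ[R] (algebraMap R S a) = (algebraMap R S a) ⊗ₜ[R] (1 : S) := by
      rw [← Algebra.TensorProduct.includeRight_apply, AlgHom.commutes]
      exact (iL.commutes a).symm
    have e1 : (1 : S) ⊗ₜ[R] (b • s - algebraMap R S a) - (b • s - algebraMap R S a) ⊗ₜ[R] (1 : S) =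
        b • ((1 : S) ⊗ₜ[R] s - s ⊗ₜ[R] (1 : S)) := by
      rw [TensorProduct.tmul_sub, TensorProduct.sub_tmul, TensorProduct.tmul_smul,
        ← TensorProduct.smul_tmul', e0, smul_sub]
      abel
    have h3 : algebraMap R T b * ((1 : S) ⊗ₜ[R] s - s ⊗ₜ[R] (1 : S)) ∈ P := by
      rw [← Algebra.smul_def, ← e1]
      exact P.sub_mem h2 h1
    rcases ‹P.IsPrime›.mem_or_mem h3 with h | h
    · exact absurd (show b ∈ p from h) hb
    · exact h
  -- conclude with the span description of the kernel
  intro x hx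
  have hx' : x ∈ (KaehlerDifferential.ideal R S).restrictScalars S := hx
  rw [← KaehlerDifferential.submodule_span_range_eq_ideal] at hx'
  have hle : Submodule.span S (Set.range fun s : S => (1 : S) ⊗ₜ[R] s - s ⊗ₜ[R] (1 : S)) ≤
      P.restrictScalars S := by
    rw [Submodule.span_le]
    rintro _ ⟨s, rfl⟩
    exact hgen s
  exact hle hx'

include hloc in
/-- **Olivier's theorem (Stacks 092Z; Bhatt–Scholze 2.3.5) in de Jong's form.** Let `R` be a
local ring with separably closed residue field over which integral domains are local, and let
`R → S` be a local weakly étale homomorphism of local rings.  Then `R → S` is bijective.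
[cite: StacksProject, Tag 092Z; BhattScholze2015, Theorem 2.3.5] -/
theorem bijective_algebraMap_of_weaklyEtale : Function.Bijective (algebraMap R S) := by
  haveI : Module.FaithfullyFlat R S := Module.FaithfullyFlat.of_flat_of_isLocalHom
  set T := S ⊗[R] S
  let μ : T →ₐ[R] S := Algebra.TensorProduct.lmul' R
  -- the kernel of `μ` is nil, hence zero (it is pure)
  have hnil : ∀ x ∈ RingHom.ker μ.toRingHom, IsNilpotent x := fun x hx => by
    rw [← mem_nilradical, nilradical_eq_sInf]
    exact Ideal.mem_sInf.2 fun P hP => by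
      haveI : P.IsPrime := hP
      exact ker_lmul'_le R S hloc P hx
  have hμ1 : ∀ s : S, μ (s ⊗ₜ[R] (1 : S)) = s := fun s => by
    change Algebra.TensorProduct.lmul' R (S := S) (s ⊗ₜ 1) = s
    rw [Algebra.TensorProduct.lmul'_apply_tmul, mul_one]
  have hμs : Function.Surjective μ.toRingHom := fun s => ⟨s ⊗ₜ 1, hμ1 s⟩
  have hker0 : ∀ x, μ x = 0 → x = 0 := by
    intro x hx
    obtain ⟨y, hy, hyx⟩ := exists_mul_eq_self_of_flat_surjective μ.toRingHom hμs
      (Algebra.WeaklyEtale.flat_lmul' R S) (x := x) hx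
    obtain ⟨n, hn⟩ := hnil y hy
    have : ∀ k : ℕ, y ^ k * x = x := by
      intro k
      induction k with
      | zero => simp
      | succ k ih => rw [pow_succ, mul_assoc, hyx, ih]
    rw [← this n, hn, zero_mul]
  have hμinj : Function.Injective μ := (injective_iff_map_eq_zero _).2 hker0
  -- `S → S ⊗[R] S` is bijective, hence so is `R → S` by faithfully flat descent
  have hbij : Function.Bijective (algebraMap S T) := by
    have hμa : ∀ s : S, μ (algebraMap S T s) = s := fun s => by
      rw [Algebra.TensorProduct.algebraMap_apply, Algebra.algebraMap_self, RingHom.id_apply]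
      exact hμ1 s
    constructor
    · intro x y h
      have := congrArg μ h
      rwa [hμa, hμa] at this
    · intro t
      exact ⟨μ t, hμinj (by rw [hμa])⟩
  exact Module.FaithfullyFlat.bijective_of_tensorProduct hbij

end Olivier



end

end Literature.RingTheory.Etale
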